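import Summits.BirchSwinnertonDyer.BirchSwinnertonDyer.Theorems.ThetaPartnerAtTwoSignedControlAtTwoRelaxedKummerCountAllLevels
import HarnessLib

/-!
# `rank_Λ Y = 1` over `ℚ` for EVERY elliptic curve and every prime from Poitou–Tate over the layers `ℚ_n`
# (the shape of conj. 5 `Greenberg1999.h1SigmaInfty_rank_eq_one` of `PublishedInputsGreenbergControlAtTwo`, 24143)

Routes TP2 / RTT, PUB conjunction `PublishedInputsGreenbergControlAtTwo` (stmt-BirchSwinnertonDyer-24143, conj. 5) and K4
`SignedControlAtTwo` (stmt-BirchSwinnertonDyer-20309); seat `bsd-inputs-r1-p1` (D-0154 (2) INPUTS row 1, input (I1)). Sequel of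
`…RelaxedKummerCountAllLevels` (`relaxedSelmer_torsion_card_growth_of_poitouTate : (∀ L, PT L) → (I1)`).

* `h1SigmaInfty_rank_eq_one_of_poitouTate_layers` — for EVERY elliptic `E/ℚ` (no `E(ℚ)[p] = 0`, no reduction hypothesis at
  `p`) and every prime `p`, `κ` cyclotomic with topological generator `γ`, good reduction off `Σ₀ ∪ {p}`, `Sel_{p^∞}(E/ℚ)`
  finite: every finitely generated Pontryagin-dual datum `Y` of `H¹(ℚ_Σ/ℚ_∞, E[p^∞])` has `rank_Λ Y = 1`, GIVEN
  `poitouTate_selmerStructure_duality L` for every number field `L` (used over the layers `ℚ_n`) — the tree's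
  `H1SigmaGrowth.h1SigmaInfty_rank_eq_one_of_relaxedCount` (≥ 1 from (I1), ≤ 1 from the PROVED corank count
  `H1SigmaCorank.h1Sigma_zpCorank_le_degree_holds_rat`, Greenberg pp. 119–120) with (I1) discharged; neither weak Leopoldt
  (Kato Thm. 12.4) nor Coates–Greenberg is used. Compare the twist road `TwistNotTorsion.…_of_poitouTate` (needs `E(K)[p] = 0`,
  uses PT over `K` only).

HONEST FRAMING: THEOREM ONLY (no definition, no named fact, no `sorry`), CONDITIONAL on the named Poitou–Tate fact over the
layers and on the displayed Selmer-finiteness hypothesis of the adapter; conj. 5 as typed (all `W`, cyclotomic `κ`, no `hSel`) is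
NOT closed by this file; no item is closed. BSD is not proved by any of this.

References: [cite: GreenbergLNM1716, §4 pp. 113, 119–120; §1 p. 62; §3 Lemma 3.1; §5 p. 140] [cite: MilneADT2006, Ch. I, Thm. 4.10]
[cite: NeukirchSchmidtWingberg2008, (8.7.9)].
-/

set_option linter.dupNamespace false

noncomputable section
open scoped Classical
open NumberField IsDedekindDomain
open Literature.NumberTheory.EllipticCurves Literature.NumberTheory.GaloisRepresentations
open Literature.NumberTheory.GaloisCohomology
namespace Summit.BirchSwinnertonDyer.BirchSwinnertonDyer.Theorems.SignedEC.RelaxedKummerCount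

open Literature.NumberTheory.EllipticCurves.ZpExtension WeierstrassCurve
  Literature.NumberTheory.EllipticCurves.IwasawaDual Literature.NumberTheory.EllipticCurves.IwasawaAlgebra
  Literature.NumberTheory.EllipticCurves.GreenbergVatsal2000 Literature.NumberTheory.EllipticCurves.Rank1Residual

/-- **`rank_Λ Y = 1` over `ℚ` for EVERY elliptic curve and every prime, from PT over the layers `ℚ_n`**
(and `Sel_{p^∞}(E/ℚ)` finite, `κ` cyclotomic with topological generator `γ`, good reduction off `Σ₀ ∪ {p}`):
`H1SigmaGrowth.h1SigmaInfty_rank_eq_one_of_relaxedCount` with (I1) discharged by §3 — the shape of conj. 5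
`Greenberg1999.h1SigmaInfty_rank_eq_one` of `PublishedInputsGreenbergControlAtTwo` (24143) under its Selmer-finiteness
hypothesis, WITHOUT weak Leopoldt (Kato Thm. 12.4) and WITHOUT Coates–Greenberg.
[cite: GreenbergLNM1716, §4 pp. 113, 119–120; §1 p. 62; §3 Lemma 3.1] [cite: MilneADT2006, Ch. I, Thm. 4.10] -/
theorem h1SigmaInfty_rank_eq_one_of_poitouTate_layers
    (hPT : ∀ (L : Type) [Field L] [NumberField L], poitouTate_selmerStructure_duality L)
    (W : WeierstrassCurve ℚ) [W.IsElliptic] (p : ℕ) [Fact p.Prime]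
    (κ : ZpExtension ℚ p) (γ : Field.absoluteGaloisGroup ℚ) (hκ : κ.IsCyclotomic) (hγ : κ.IsTopGenerator γ)
    (S₀ : Finset (HeightOneSpectrum (𝓞 ℚ)))
    (hgood : ∀ v : HeightOneSpectrum (𝓞 ℚ), v ∉ S₀ → ((p : ℕ) : 𝓞 ℚ) ∉ v.asIdeal → W.HasGoodReductionAt v)
    (hSel : Finite (W.selmerGroupPInfty p))
    (Y : Type) [AddCommGroup Y] [Module (IwasawaAlgebra p) Y] [Module.Finite (IwasawaAlgebra p) Y]
    (dY : Y →+ (unramifiedOutside κ.kerSubgroup (W.geomPrimaryTorsion p) p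
      (↑S₀ : Set (HeightOneSpectrum (𝓞 ℚ))) →+ AddCircle (1 : ℚ)))
    (hbij : Function.Bijective dY)
    (hT : ∀ (y : Y) (c : unramifiedOutside κ.kerSubgroup (W.geomPrimaryTorsion p) p
        (↑S₀ : Set (HeightOneSpectrum (𝓞 ℚ)))),
      dY ((PowerSeries.X : IwasawaAlgebra p) • y) c =
        dY y ⟨W.conjH1 p κ.kerSubgroup γ c,
          conjH1_mem_unramifiedOutside κ.kerSubgroup (W.geomPrimaryTorsion p) p _ γ c.2⟩ - dY y c)
    (hC : ∀ (a : ℤ_[p]) (y : Y) (c : unramifiedOutside κ.kerSubgroup (W.geomPrimaryTorsion p) p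
        (↑S₀ : Set (HeightOneSpectrum (𝓞 ℚ)))) (k : ℕ), (p ^ k) • c = 0 →
      dY (PowerSeries.C a • y) c = (PadicInt.toZModPow k a).val • dY y c) :
    Module.rank (IwasawaAlgebra p) Y = 1 :=
  H1SigmaGrowth.h1SigmaInfty_rank_eq_one_of_relaxedCount W p κ γ hκ hγ S₀ hgood
    (relaxedSelmer_torsion_card_growth_of_poitouTate hPT) hSel Y dY hbij hT hC


end Summit.BirchSwinnertonDyer.BirchSwinnertonDyer.Theorems.SignedEC.RelaxedKummerCount

end
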